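import Mathlib
import Literature.NumberTheory.Sieve.SingularSeries

/-!
# Crux `EngineToGHL` (stmt-Parity-14995, route LiouvilleMAD), line `tuple_ladder`, stub `stub_rungWeights`

Arithmetic of the sieve weight of the rung of the tuple ladder.  For a finite `H' ⊆ ℕ` and a shift
`hs` exceeding every element of `H'` put

  `w(d) := 𝟙[∀ h ∈ H', (d - hs % d + h, d) = 1] / #{ρ < d : ∀ h ∈ H', (ρ + h, d) = 1}`

(a real number, with the convention `0⁻¹ = 0`).  We prove: `d ↦ μ(d) · d · w(d)` is a
multiplicative real arithmetic function `G` (the admissible-class count is multiplicative by the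
Chinese remainder theorem, the indicator is `𝟙[(hs - h, d) = 1 ∀ h ∈ H']`), `G = b ⋆ μ` with
`b := G ⋆ ζ` multiplicative and `b(p^k) = 1 - p · w(p)` (`k ≥ 1`); at a prime `p`, `w(p) = 0` if
`p ∣ hs - h` for some `h ∈ H'` and `w(p) = 1/(p - ν_{H'}(p))` otherwise, where
`ν_{H'}(p) = #(H' mod p)`; `ν_{H' ∪ {hs}}(p) = ν_{H'}(p) + 𝟙[p ∤ hs - h ∀ h ∈ H']`, and `ν_{H'}(p) < p`
in the latter case.

* `stub_rungWeights` — the registered statement (template: `PairsFromMAvg.exists_weights`).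

[folklore]
-/

noncomputable section

open Finset Real ArithmeticFunction Filter
open scoped ArithmeticFunction.Moebius ArithmeticFunction.zeta

namespace Summit.Parity.GeneralizedHardyLittlewood.Theorems.EngineToGHL.TupleLadder

open Literature.NumberTheory.Sieve (tupleResidueCount)

/-! ### The indicator `𝟙[∀ h ∈ H', (d - hs % d + h, d) = 1]` -/

/-- `(d - hs % d + h, d) = 1 ↔ (hs - h, d) = 1` for `d ≠ 0` and `h ≤ hs`, since
`d - hs % d + h ≡ -(hs - h) (mod d)`. [folklore] -/
theorem coprime_sub_mod_add_iff {d hs h : ℕ} (hd : d ≠ 0) (hh : h ≤ hs) :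
    Nat.Coprime (d - hs % d + h) d ↔ Nat.Coprime (hs - h) d := by
  have h1 : hs % d ≤ d := (Nat.mod_lt _ (Nat.pos_of_ne_zero hd)).le
  have hcast : ((d - hs % d + h : ℕ) : ZMod d) = -((hs - h : ℕ) : ZMod d) := by
    rw [Nat.cast_add, Nat.cast_sub h1, Nat.cast_sub hh, ZMod.natCast_self, ZMod.natCast_mod]
    ring
  rw [← ZMod.isUnit_iff_coprime, ← ZMod.isUnit_iff_coprime, hcast, IsUnit.neg_iff]

/-- The indicator is multiplicative in the modulus: for `m, n ≠ 0` the class `-hs` is admissible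
modulo `m n` iff it is admissible modulo `m` and modulo `n`. [folklore] -/
theorem indicator_mul_iff (H' : Finset ℕ) {hs m n : ℕ} (hH : ∀ h ∈ H', h < hs) (hm : m ≠ 0)
    (hn : n ≠ 0) :
    (∀ h ∈ H', Nat.Coprime (m * n - hs % (m * n) + h) (m * n)) ↔
      (∀ h ∈ H', Nat.Coprime (m - hs % m + h) m) ∧ (∀ h ∈ H', Nat.Coprime (n - hs % n + h) n) := by
  have key : ∀ h ∈ H', (Nat.Coprime (m * n - hs % (m * n) + h) (m * n) ↔
      Nat.Coprime (m - hs % m + h) m ∧ Nat.Coprime (n - hs % n + h) n) := by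
    intro h hh
    rw [coprime_sub_mod_add_iff (mul_ne_zero hm hn) (hH h hh).le,
      coprime_sub_mod_add_iff hm (hH h hh).le, coprime_sub_mod_add_iff hn (hH h hh).le,
      Nat.coprime_mul_iff_right]
  constructor
  · intro hall
    exact ⟨fun h hh => ((key h hh).mp (hall h hh)).1, fun h hh => ((key h hh).mp (hall h hh)).2⟩
  · rintro ⟨h1, h2⟩ h hh
    exact (key h hh).mpr ⟨h1 h hh, h2 h hh⟩

/-- At a prime `p` (and `h < hs` on `H'`): the class `-hs` is admissible mod `p` iff no `h ∈ H'`
has `p ∣ hs - h`. [folklore] -/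
theorem indicator_prime_iff (H' : Finset ℕ) {hs p : ℕ} (hH : ∀ h ∈ H', h < hs) (hp : p.Prime) :
    (∀ h ∈ H', Nat.Coprime (p - hs % p + h) p) ↔ ¬ ∃ h ∈ H', p ∣ hs - h := by
  rw [not_exists]
  refine forall_congr' fun h => ?_
  rw [not_and]
  refine imp_congr_right fun hh => ?_
  rw [coprime_sub_mod_add_iff hp.ne_zero (hH h hh).le, Nat.coprime_comm, hp.coprime_iff_not_dvd]

/-! ### The admissible-class count `#{ρ < d : (ρ + h, d) = 1 ∀ h ∈ H'}` -/

/-- `(ρ + h, d) = 1` iff `ρ + h` is a unit mod `d`. [folklore] -/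
theorem coprime_add_iff_isUnit (ρ h d : ℕ) :
    Nat.Coprime (ρ + h) d ↔ IsUnit ((ρ : ZMod d) + (h : ZMod d)) := by
  rw [← Nat.cast_add, ZMod.isUnit_iff_coprime]

open scoped Classical in
/-- The admissible classes `{ρ < d : (ρ + h, d) = 1 ∀ h ∈ H'}` counted in `ZMod d` (`ρ ↦ ρ mod d`
is a bijection `[0, d) → ZMod d`). [folklore] -/
theorem card_admissible_eq_card_zmod (H' : Finset ℕ) (d : ℕ) [NeZero d] :
    ((Finset.range d).filter (fun ρ : ℕ => ∀ h ∈ H', Nat.Coprime (ρ + h) d)).card =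
      ((Finset.univ : Finset (ZMod d)).filter
        (fun x : ZMod d => ∀ h ∈ H', IsUnit (x + (h : ZMod d)))).card := by
  refine Finset.card_nbij' (fun ρ : ℕ => (ρ : ZMod d)) (fun x : ZMod d => x.val) ?_ ?_ ?_ ?_
  · intro ρ hρ
    rw [Finset.mem_coe, Finset.mem_filter] at hρ ⊢
    exact ⟨Finset.mem_univ _, fun h hh => (coprime_add_iff_isUnit ρ h d).mp (hρ.2 h hh)⟩
  · intro x hx
    rw [Finset.mem_coe, Finset.mem_filter] at hx ⊢
    refine ⟨Finset.mem_range.mpr (ZMod.val_lt x), fun h hh => ?_⟩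
    rw [coprime_add_iff_isUnit, ZMod.natCast_zmod_val]
    exact hx.2 h hh
  · intro ρ hρ
    rw [Finset.mem_coe, Finset.mem_filter, Finset.mem_range] at hρ
    show (ρ : ZMod d).val = ρ
    rw [ZMod.val_natCast, Nat.mod_eq_of_lt hρ.1]
  · intro x _
    exact ZMod.natCast_zmod_val x

/-- **CRT.** The admissible-class count is multiplicative in the modulus: for coprime `m, n ≠ 0`,
`#{ρ < mn : …} = #{ρ < m : …} · #{ρ < n : …}` (`ZMod (mn) ≃+* ZMod m × ZMod n` preserves units
componentwise). [folklore] -/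
theorem card_admissible_mul (H' : Finset ℕ) {m n : ℕ} (hm : m ≠ 0) (hn : n ≠ 0)
    (hmn : Nat.Coprime m n) :
    ((Finset.range (m * n)).filter (fun ρ : ℕ => ∀ h ∈ H', Nat.Coprime (ρ + h) (m * n))).card =
      ((Finset.range m).filter (fun ρ : ℕ => ∀ h ∈ H', Nat.Coprime (ρ + h) m)).card *
        ((Finset.range n).filter (fun ρ : ℕ => ∀ h ∈ H', Nat.Coprime (ρ + h) n)).card := by
  classical
  haveI : NeZero m := ⟨hm⟩
  haveI : NeZero n := ⟨hn⟩
  haveI : NeZero (m * n) := ⟨mul_ne_zero hm hn⟩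
  rw [card_admissible_eq_card_zmod, card_admissible_eq_card_zmod, card_admissible_eq_card_zmod,
    ← Finset.card_product, ← Finset.filter_product, Finset.univ_product_univ]
  refine Finset.card_equiv (ZMod.chineseRemainder hmn).toEquiv (fun x => ?_)
  simp only [Finset.mem_filter, Finset.mem_univ, true_and]
  have key : ∀ h : ℕ, IsUnit (x + (h : ZMod (m * n))) ↔
      IsUnit (((ZMod.chineseRemainder hmn).toEquiv x).1 + (h : ZMod m)) ∧
        IsUnit (((ZMod.chineseRemainder hmn).toEquiv x).2 + (h : ZMod n)) := by
    intro h
    rw [← MulEquiv.isUnit_map (ZMod.chineseRemainder hmn), map_add, map_natCast, Prod.isUnit_iff,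
      Prod.fst_add, Prod.snd_add, Prod.fst_natCast, Prod.snd_natCast]
    rfl
  constructor
  · intro hall
    exact ⟨fun h hh => ((key h).mp (hall h hh)).1, fun h hh => ((key h).mp (hall h hh)).2⟩
  · rintro ⟨h1, h2⟩ h hh
    exact (key h).mpr ⟨h1 h hh, h2 h hh⟩

/-- `ν_{H'}(p)` for `H' ⊆ ℕ` is the number of classes `h mod p`, `h ∈ H'`. [folklore] -/
theorem tupleResidueCount_image_natCast (H' : Finset ℕ) (p : ℕ) :
    tupleResidueCount (H'.image (fun h : ℕ => (h : ℤ))) p =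
      (H'.image (fun h : ℕ => (h : ZMod p))).card := by
  unfold tupleResidueCount
  rw [Finset.image_image]
  have hcomp : ((fun h : ℤ => (h : ZMod p)) ∘ (fun h : ℕ => (h : ℤ))) = (fun h : ℕ => (h : ZMod p)) :=
    funext fun x => by simp
  rw [hcomp]

/-- `ν_{H'}(p) ≤ p` (`p ≠ 0`). [folklore] -/
theorem tupleResidueCount_le (H' : Finset ℕ) (p : ℕ) [NeZero p] :
    tupleResidueCount (H'.image (fun h : ℕ => (h : ℤ))) p ≤ p := by
  rw [tupleResidueCount_image_natCast]
  calc (H'.image (fun h : ℕ => (h : ZMod p))).card ≤ Fintype.card (ZMod p) := Finset.card_le_univ _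
    _ = p := ZMod.card p

/-- At a prime `p` the admissible classes are the complement of `{-h mod p : h ∈ H'}`, so their
number is `p - ν_{H'}(p)`. [folklore] -/
theorem card_admissible_prime (H' : Finset ℕ) {p : ℕ} (hp : p.Prime) :
    ((Finset.range p).filter (fun ρ : ℕ => ∀ h ∈ H', Nat.Coprime (ρ + h) p)).card =
      p - tupleResidueCount (H'.image (fun h : ℕ => (h : ℤ))) p := by
  classical
  haveI := Fact.mk hp
  rw [card_admissible_eq_card_zmod, tupleResidueCount_image_natCast]
  have hS : (Finset.univ : Finset (ZMod p)).filter
      (fun x : ZMod p => ∀ h ∈ H', IsUnit (x + (h : ZMod p))) =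
        Finset.univ \ H'.image (fun h : ℕ => -(h : ZMod p)) := by
    ext x
    simp only [Finset.mem_filter, Finset.mem_univ, true_and, Finset.mem_sdiff, Finset.mem_image,
      not_exists, not_and, isUnit_iff_ne_zero, ne_eq, add_eq_zero_iff_neg_eq']
  have hneg : H'.image (fun h : ℕ => -(h : ZMod p)) =
      (H'.image (fun h : ℕ => (h : ZMod p))).image (fun y : ZMod p => -y) := by
    rw [Finset.image_image]
    rfl
  rw [hS, Finset.card_univ_sdiff, ZMod.card, hneg, Finset.card_image_of_injective _ neg_injective]

/-! ### `ν` of the enlarged tuple -/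

/-- `ν_{H' ∪ {hs}}(p) = ν_{H'}(p) + 𝟙[p ∤ hs - h ∀ h ∈ H']` when every `h ∈ H'` is `< hs`
(`hs ≡ h (mod p) ↔ p ∣ hs - h`). [folklore] -/
theorem tupleResidueCount_insert (H' : Finset ℕ) {hs : ℕ} (hH : ∀ h ∈ H', h < hs) (p : ℕ) :
    tupleResidueCount ((insert hs H').image (fun h : ℕ => (h : ℤ))) p =
      tupleResidueCount (H'.image (fun h : ℕ => (h : ℤ))) p +
        (if (∃ h ∈ H', p ∣ hs - h) then 0 else 1) := by
  rw [tupleResidueCount_image_natCast, tupleResidueCount_image_natCast, Finset.image_insert]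
  have hmem : (hs : ZMod p) ∈ H'.image (fun h : ℕ => (h : ZMod p)) ↔ ∃ h ∈ H', p ∣ hs - h := by
    rw [Finset.mem_image]
    refine exists_congr fun h => and_congr_right fun hh => ?_
    rw [ZMod.natCast_eq_natCast_iff, Nat.modEq_iff_dvd' (hH h hh).le]
  by_cases hex : ∃ h ∈ H', p ∣ hs - h
  · rw [if_pos hex, Finset.card_insert_of_mem (hmem.mpr hex), add_zero]
  · rw [if_neg hex, Finset.card_insert_of_notMem (fun hm => hex (hmem.mp hm))]

/-- If no `h ∈ H'` has `p ∣ hs - h` (`p ≠ 0`), the class of `hs` is missed by `H'` mod `p`, so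
`ν_{H'}(p) < p`. [folklore] -/
theorem tupleResidueCount_lt (H' : Finset ℕ) {hs : ℕ} (hH : ∀ h ∈ H', h < hs) (p : ℕ) [NeZero p]
    (hex : ¬ ∃ h ∈ H', p ∣ hs - h) :
    tupleResidueCount (H'.image (fun h : ℕ => (h : ℤ))) p < p := by
  have h1 := tupleResidueCount_insert H' hH p
  rw [if_neg hex] at h1
  have h2 := tupleResidueCount_le (insert hs H') p
  omega

/-! ### The weight at a prime and as a multiplicative function -/

/-- At a prime `p`: `w(p) = 0` if `p ∣ hs - h` for some `h ∈ H'`, and `w(p) = 1/(p - ν_{H'}(p))`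
otherwise. [folklore] -/
theorem weight_prime (H' : Finset ℕ) {hs : ℕ} (hH : ∀ h ∈ H', h < hs) {p : ℕ} (hp : p.Prime) :
    (if ∀ h ∈ H', Nat.Coprime (p - hs % p + h) p then
        (((Finset.range p).filter (fun ρ : ℕ => ∀ h ∈ H', Nat.Coprime (ρ + h) p)).card : ℝ)⁻¹
      else 0) =
      (if (∃ h ∈ H', p ∣ hs - h) then 0
        else ((p : ℝ) - tupleResidueCount (H'.image (fun h : ℕ => (h : ℤ))) p)⁻¹) := by
  haveI : NeZero p := ⟨hp.ne_zero⟩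
  by_cases hex : ∃ h ∈ H', p ∣ hs - h
  · rw [if_neg (fun hall => (indicator_prime_iff H' hH hp).mp hall hex), if_pos hex]
  · rw [if_pos ((indicator_prime_iff H' hH hp).mpr hex), if_neg hex, card_admissible_prime H' hp,
      Nat.cast_sub (tupleResidueCount_le H' p)]

/-- The weight `w`, extended by `w(0) := 0`, is a multiplicative real arithmetic function.
[folklore] -/
theorem exists_weight (H' : Finset ℕ) {hs : ℕ} (hH : ∀ h ∈ H', h < hs) :
    ∃ W : ArithmeticFunction ℝ, W.IsMultiplicative ∧ ∀ d : ℕ, d ≠ 0 → W d =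
      (if ∀ h ∈ H', Nat.Coprime (d - hs % d + h) d then
        (((Finset.range d).filter (fun ρ : ℕ => ∀ h ∈ H', Nat.Coprime (ρ + h) d)).card : ℝ)⁻¹
        else 0) := by
  set w : ℕ → ℝ := fun d => if ∀ h ∈ H', Nat.Coprime (d - hs % d + h) d then
      (((Finset.range d).filter (fun ρ : ℕ => ∀ h ∈ H', Nat.Coprime (ρ + h) d)).card : ℝ)⁻¹
      else 0 with hw
  refine ⟨⟨fun d => if d = 0 then 0 else w d, if_pos rfl⟩, ⟨?_, ?_⟩, fun d hd => ?_⟩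
  · rw [ArithmeticFunction.coe_mk, if_neg one_ne_zero, hw]
    simp
  · intro m n hmn
    simp only [ArithmeticFunction.coe_mk]
    by_cases hm : m = 0
    · subst hm; simp
    by_cases hn : n = 0
    · subst hn; simp
    rw [if_neg (mul_ne_zero hm hn), if_neg hm, if_neg hn, hw]
    simp only
    rw [card_admissible_mul H' hm hn hmn, Nat.cast_mul, mul_inv]
    by_cases h1 : ∀ h ∈ H', Nat.Coprime (m - hs % m + h) m
    · by_cases h2 : ∀ h ∈ H', Nat.Coprime (n - hs % n + h) n
      · rw [if_pos ((indicator_mul_iff H' hH hm hn).mpr ⟨h1, h2⟩), if_pos h1, if_pos h2]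
      · rw [if_neg (fun h12 => h2 ((indicator_mul_iff H' hH hm hn).mp h12).2), if_neg h2, mul_zero]
    · rw [if_neg (fun h12 => h1 ((indicator_mul_iff H' hH hm hn).mp h12).1), if_neg h1, zero_mul]
  · rw [ArithmeticFunction.coe_mk, if_neg hd]

/-! ### The registered statement -/

/-- **Arithmetic of the sieve weight of the rung.**  For the sub-tuple `H'` and the adjoined shift
`hs > max H'` put `w(d) := 𝟙[∀ h ∈ H', (d - hs % d + h, d) = 1] / #{ρ < d : ∀ h ∈ H', (ρ+h,d)=1}`
(the weight the relative tuple-EH `Level(H')` attaches to the class `-hs (mod d)`).  Then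
`d ↦ μ(d)·d·w(d)` is a multiplicative real arithmetic function `G` (CRT: the admissible-class count
is multiplicative, the indicator is `𝟙[(d, ∏(hs-h)) = 1]`), `G = b ⋆ μ` with `b := G ⋆ ζ`
multiplicative and `b(p^k) = 1 + G(p) = 1 - p·w(p)` (`k ≥ 1`); at a prime `p`: `w(p) = 0` if
`p ∣ hs - h` for some `h ∈ H'`, else `w(p) = 1/(p - ν_{H'}(p))` where `ν_{H'}(p) = #(H' mod p) < p`;
and `ν_{H'∪{hs}}(p) = ν_{H'}(p) + 𝟙[p ∤ hs - h ∀ h]`. [folklore] -/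
theorem stub_rungWeights : ∀ (H' : Finset ℕ) (hs : ℕ), (∀ h ∈ H', h < hs) → ∃ G b : ArithmeticFunction ℝ, G.IsMultiplicative ∧ b.IsMultiplicative ∧ (∀ d : ℕ, d ≠ 0 → G d = (ArithmeticFunction.moebius d : ℝ) * (d : ℝ) * (if ∀ h ∈ H', Nat.Coprime (d - hs % d + h) d then (((Finset.range d).filter (fun ρ : ℕ => ∀ h ∈ H', Nat.Coprime (ρ + h) d)).card : ℝ)⁻¹ else 0)) ∧ b * (ArithmeticFunction.moebius : ArithmeticFunction ℝ) = G ∧ (∀ p k : ℕ, p.Prime → 1 ≤ k → b (p ^ k) = 1 - (p : ℝ) * (if ∀ h ∈ H', Nat.Coprime (p - hs % p + h) p then (((Finset.range p).filter (fun ρ : ℕ => ∀ h ∈ H', Nat.Coprime (ρ + h) p)).card : ℝ)⁻¹ else 0)) ∧ (∀ p : ℕ, p.Prime → (if ∀ h ∈ H', Nat.Coprime (p - hs % p + h) p then (((Finset.range p).filter (fun ρ : ℕ => ∀ h ∈ H', Nat.Coprime (ρ + h) p)).card : ℝ)⁻¹ else 0) = (if (∃ h ∈ H', p ∣ hs - h)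 then 0 else ((p : ℝ) - Literature.NumberTheory.Sieve.tupleResidueCount ((H').image (fun h : ℕ => (h : ℤ))) p)⁻¹)) ∧ (∀ p : ℕ, p.Prime → (Literature.NumberTheory.Sieve.tupleResidueCount ((insert hs H').image (fun h : ℕ => (h : ℤ))) p : ℝ) = Literature.NumberTheory.Sieve.tupleResidueCount ((H').image (fun h : ℕ => (h : ℤ))) p + (if (∃ h ∈ H', p ∣ hs - h) then 0 else 1)) ∧ (∀ p : ℕ, p.Prime → ¬ (∃ h ∈ H', p ∣ hs - h) → Literature.NumberTheory.Sieve.tupleResidueCount ((H').image (fun h : ℕ => (h : ℤ))) p < p) := by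
  intro H' hs hH
  obtain ⟨W, hWm, hW⟩ := exists_weight H' hH
  set G : ArithmeticFunction ℝ := (μ : ArithmeticFunction ℝ).pmul
      (((ArithmeticFunction.id : ArithmeticFunction ℕ) : ArithmeticFunction ℝ).pmul W) with hGdef
  have hGm : G.IsMultiplicative :=
    isMultiplicative_moebius.intCast.pmul (isMultiplicative_id.natCast.pmul hWm)
  have hG : ∀ d : ℕ, d ≠ 0 → G d = (μ d : ℝ) * (d : ℝ) *
      (if ∀ h ∈ H', Nat.Coprime (d - hs % d + h) d then
        (((Finset.range d).filter (fun ρ : ℕ => ∀ h ∈ H', Nat.Coprime (ρ + h) d)).card : ℝ)⁻¹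
        else 0) := by
    intro d hd
    rw [hGdef, pmul_apply, pmul_apply, intCoe_apply, natCoe_apply, id_apply, hW d hd, mul_assoc]
  refine ⟨G, G * (ζ : ArithmeticFunction ℝ), hGm, hGm.mul isMultiplicative_zeta.natCast, hG,
    ?_, ?_, fun p hp => weight_prime H' hH hp, fun p hp => ?_, fun p hp hex => ?_⟩
  · rw [mul_assoc, coe_zeta_mul_coe_moebius, mul_one]
  · intro p k hp hk
    rw [coe_mul_zeta_apply, Nat.sum_divisors_prime_pow hp]
    have hG1 : G 1 = 1 := hGm.map_one
    have hGpk : ∀ i, 2 ≤ i → G (p ^ i) = 0 := by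
      intro i hi
      rw [hG _ (pow_ne_zero _ hp.ne_zero), moebius_apply_prime_pow hp (by omega), if_neg (by omega)]
      simp
    have hsum : ∀ j, ∑ i ∈ Finset.range (j + 2), G (p ^ i) = 1 + G p := by
      intro j
      induction j with
      | zero => rw [Finset.sum_range_succ, Finset.sum_range_one, pow_zero, pow_one, hG1]
      | succ j ih =>
        rw [show j + 1 + 2 = (j + 2) + 1 by ring, Finset.sum_range_succ, ih, hGpk (j + 2) (by omega),
          add_zero]
    obtain ⟨j, rfl⟩ : ∃ j, k = j + 1 := ⟨k - 1, by omega⟩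
    rw [show j + 1 + 1 = j + 2 by ring, hsum, hG p hp.ne_zero, moebius_apply_prime hp]
    push_cast
    ring
  · exact_mod_cast tupleResidueCount_insert H' hH p
  · haveI : NeZero p := ⟨hp.ne_zero⟩
    exact tupleResidueCount_lt H' hH p hex

end Summit.Parity.GeneralizedHardyLittlewood.Theorems.EngineToGHL.TupleLadder
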